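import Summits.CriticalPhenomena.CardyFormulaZ2.Theses.CardyOrderDuality
import Literature.Probability.Percolation.ZdNearCriticalWindow

/-!
# Birth skeleton (BC3) for the crux `UniformRefinementDominance` — stmt-CriticalPhenomena-4715

Route `CardyOrderDuality` (rank 3, the route's thesis X_OD), sub-problem `CardyFormulaZ2`:

  `UniformRefinementDominance : ∀ (R : ConformalRectangle) (ε : ℝ), 0 < ε → ∃ δ₀ : ℝ, 0 < δ₀ ∧
      ∀ δ δ' : ℝ, 0 < δ' → δ' ≤ δ → δ ≤ δ₀ → bondDomainCrossingProb R δ' ≤ bondDomainCrossingProb R δ + ε`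

— "refinement never helps, asymptotically": the uniform ONE-SIDED Cauchy criterion for the
`P_{1/2}` bond-`ℤ²` crossing probability `P^δ(R) = bondDomainCrossingProb R δ` of a conformal rectangle.

## The line: SPRINKLED cross-scale domination in Kesten's window + window continuity

This is the layer-2 split the route header itself foresees ("UniformRefinementDominance ⇐
SprinkledUniformDomination (with Kesten's window w(δ), once the ℤ² four-arm / window API exists) →
WindowContinuity → UniformRefinementDominance"), now typeable because the bond-`ℤ²` near-critical
API has landed in `Literature/Probability/Percolation/ZdNearCriticalWindow.lean`:
`zdNearCriticalWindow N = w(N) := (N² α₄(1,N))⁻¹` (Kesten's window = GPS zooming factor),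
`zdNearCriticalCrossingProb lam R δ = P^{δ}_{1/2 + λ·w(⌊1/δ⌋)}(R)` (the crossing probability of `R` at
mesh `δ` under the near-critical law), whose `λ = 0` slice is LITERALLY `bondDomainCrossingProb R δ`
(`zdNearCriticalCrossingProb_zero`) and which is monotone in `λ` (`zdNearCriticalCrossingProb_mono`).

Write `P δ := bondDomainCrossingProb R δ` and `Q_λ δ := zdNearCriticalCrossingProb λ R δ`.

* `stub_sprinkledDomination` (SCSD at the level of subsequential limits; LOAD-BEARING, hardest, size XL):
  for every conformal rectangle `R` and every budget `λ > 0`,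
  `limsup_{δ'→0⁺} P δ' ≤ liminf_{δ→0⁺} Q_λ δ` — every subsequential limit of the CRITICAL crossing
  probability is dominated by every subsequential limit of the `λ`-SPRINKLED one: "critical
  percolation at any finer mesh is stochastically below slightly super-critical percolation at any
  coarser mesh, on the crossing event, with a sprinkling budget of `λ` Kesten windows". This is the
  statement a monotone cross-scale (renormalisation / exploration-organised) coupling with budget
  `λ·w` delivers (GrimmettPercolation1999 §7.2 sprinkling; arXiv:1305.5526, arXiv:0803.3785
  near-critical monotone couplings); the uniformity-in-two-meshes bookkeeping of X_OD is NOT in the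
  stub — it is recovered in the composition below from limsup/liminf.
* `stub_windowContinuity` (bond-`ℤ²` near-critical stability at the scale of the window; size L):
  for every `R` and `ε > 0` there is `λ > 0` with `Q_λ δ ≤ P δ + ε` for all small `δ`, i.e.
  `lim_{λ→0⁺} limsup_{δ→0⁺} (Q_λ δ - P δ) = 0` (`Q_λ` is monotone in `λ`): moving `p` by `λ·w(1/δ)`
  changes the crossing probability of `Ω_δ` by `O_R(λ)` uniformly in small `δ` — Russo's formula and
  the pivotal count `E_p[#pivotal edges of C_δ(Ω)] ≍ δ⁻²α₄(1,1/δ) = w(1/δ)⁻¹` throughout Kesten's window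
  (KestenScalingCMP1987 Thm 1/(4.5); Nolin2008 §§6–7; arXiv:2111.14414 (DMT 2021, bond-ℤ² covered,
  Remark 2.3); GarbanPeteSchramm2013 Pivotal measures §2 for quads). Boundary pivotals near wild
  Jordan arcs are the only non-printed point (cf. the DualSum caveat, stmt-CriticalPhenomena-4716).

Device (D-0027 §3.3, as in `Cruxes/CardyRigidity/Lines/birth.lean`): each stub is a sorried theorem
`Holds.stub_<name> : <full statement over tree declarations>` (registered under the short name
`stub_<name>` with that text) plus the by-name handle `def stub_<name> : Prop := type_of% Holds.stub_<name>`;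
the hypotheses of `UniformRefinementDominance_of` are exactly these two handles, by name.

Composition `UniformRefinementDominance_of` (real proof, no sorry, ≈ 35 lines): given `R, ε`, window
continuity at `ε/3` gives `λ > 0` and eventually `Q_λ δ ≤ P δ + ε/3`; domination at this `λ` gives
`A := limsup P ≤ liminf Q_λ`; since `P, Q_λ ∈ [0,1]` are bounded, eventually `P δ' < A + ε/3`
(`eventually_lt_of_limsup_lt`) and eventually `A - ε/3 < Q_λ δ` (`eventually_lt_of_lt_liminf`);
the three eventualities hold on a common `Ioc 0 δ₀` (`mem_nhdsGT_iff_exists_Ioc_subset`), and for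
`0 < δ' ≤ δ ≤ δ₀`: `P δ' < A + ε/3 < Q_λ δ + 2ε/3 ≤ P δ + ε`.

Why S is NOT split further into octave steps (recorded dead end, checked on paper 2026-08-17): a
fixed-ratio sprinkled domination `P^{δ/2}_{1/2+s} ≤ P^{δ}_{1/2+s'}` iterated over `k` octaves does not
telescope to S. In WINDOW units the budgets add (`μ_j = μ_{j+1} + λ₀`, total `k·λ₀ → ∞`), because a
fixed absolute offset `s` is MORE super-critical at the finer mesh (`s / w(2N) ≈ 2^{3/4} · s / w(N)`,
near-critical scaling covariance, GPS 2018 §1.2); and the absolute-offset octave statement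
"`P^{δ'}_{1/2+s} ≤ P^{δ}_{1/2+s+λ₀w(N)}` for all `s ≤ Λ·w(N)`, `δ' ∈ [δ/2, δ]`", whose budgets WOULD sum
geometrically (`Σ_i w(2^i N) ≤ C·w(N)` by quasi-multiplicativity + the a-priori bound
`α₄(n,N) ≥ c (n/N)^{2-θ}`, cf. `ZdFourArmAPrioriLowerBound.lean`), is false for `Λ ≳ λ₀/(2^{3/4}-1)`
by the same covariance. So the uniformity across arbitrarily separated meshes in S must come from ONE
global coupling (coarse-graining ratio → ∞ at fixed budget), exactly the obstruction recorded in the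
crux's why-might-fail; S is stated at the level of sub-limits so that only this global content remains.

Disproof / dead lines honoured: no `Disproof.lean`, no registered line and no dead line exist for
this crux yet (`ledger crux ls stmt-CriticalPhenomena-4715`: no workfiles, 2026-08-17); the negatives
index of the summit has no statement about δ-dependence of ℤ² crossing probabilities. Neither stub
restates the crux (S speaks about the near-critical family at `λ > 0` and only about sub-limits; W is
a near-critical stability statement that says nothing across meshes) nor the summit.
-/

noncomputable section

namespace Summit.CriticalPhenomena.CardyFormulaZ2.Cruxes.UniformRefinementDominance.Birth

open scoped Topology
open Set Filter
open Summit.CriticalPhenomena.CardyFormulaZ2.Theses.CardyOrderDuality (UniformRefinementDominance)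

/-! ### The two registered stubs (the ONLY `sorry`s of this file) and their by-name handles -/

/-- **Stub S — sprinkled cross-scale domination of sub-limits (SCSD in Kesten's window).**
For every conformal rectangle `R` and every `λ > 0`: every subsequential limit (as the mesh `δ' → 0⁺`)
of the critical crossing probability `P^{δ'}_{1/2}(R)` is at most every subsequential limit (as
`δ → 0⁺`) of the sprinkled crossing probability `P^{δ}_{1/2+λ·w(⌊1/δ⌋)}(R)`, `w` = Kesten's window
`zdNearCriticalWindow`. The load-bearing, hardest stub (size XL): the output of a monotone
cross-scale coupling with a budget of `λ` windows. -/
protected theorem Holds.stub_sprinkledDomination : ∀ (R : Literature.Probability.RandomPlanarGeometry.ConformalRectangle) (lam : ℝ), 0 < lam → Filter.limsup (Literature.Probability.Percolation.bondDomainCrossingProb R) (nhdsWithin (0 : ℝ) (Set.Ioi 0)) ≤ Filter.liminf (fun δ : ℝ => Literature.Probability.Percolation.zdNearCriticalCrossingProb lam R δ) (nhdsWithin (0 : ℝ) (Set.Ioi 0)) := by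
  sorry

/-- By-name handle of the registered stub `Holds.stub_sprinkledDomination`. -/
def stub_sprinkledDomination : Prop := type_of% Holds.stub_sprinkledDomination

/-- **Stub W — window continuity (near-critical stability of bond-`ℤ²` crossing probabilities at the
scale of Kesten's window).** For every conformal rectangle `R` and `ε > 0` there is a budget `λ > 0`
such that, for all sufficiently small meshes `δ`, sprinkling from `p = 1/2` to `1/2 + λ·w(⌊1/δ⌋)` raises
the crossing probability of `R` at mesh `δ` by at most `ε` (Russo's formula + the pivotal count
`≍ w⁻¹` in the window; Kesten 1987, Nolin 2008 §§6–7, DMT 2021 for bond-ℤ²). Size L. -/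
protected theorem Holds.stub_windowContinuity : ∀ (R : Literature.Probability.RandomPlanarGeometry.ConformalRectangle) (ε : ℝ), 0 < ε → ∃ lam : ℝ, 0 < lam ∧ ∀ᶠ δ in nhdsWithin (0 : ℝ) (Set.Ioi 0), Literature.Probability.Percolation.zdNearCriticalCrossingProb lam R δ ≤ Literature.Probability.Percolation.bondDomainCrossingProb R δ + ε := by
  sorry

/-- By-name handle of the registered stub `Holds.stub_windowContinuity`. -/
def stub_windowContinuity : Prop := type_of% Holds.stub_windowContinuity

/-! ### Composition (sorry-free): the two stubs imply the crux BY NAME -/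

/-- **The composition (real proof).** Window continuity at `ε/3` fixes the budget `λ`; sprinkled
domination at that `λ` orders `limsup P ≤ liminf Q_λ`; boundedness in `[0,1]` turns the two into
eventual inequalities on a common interval `(0, δ₀]`, and chaining them gives the uniform one-sided
Cauchy criterion `P δ' ≤ P δ + ε` for `0 < δ' ≤ δ ≤ δ₀` — the crux
`CardyOrderDuality.UniformRefinementDominance`, BY NAME. -/
theorem UniformRefinementDominance_of :
    stub_sprinkledDomination → stub_windowContinuity → UniformRefinementDominance := by
  intro hS hW
  dsimp only [stub_sprinkledDomination, stub_windowContinuity] at hS hW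
  intro R ε hε
  have hε3 : 0 < ε / 3 := by positivity
  -- W: the budget λ and the eventual window-continuity inequality
  obtain ⟨lam, hlam, hWev⟩ := hW R (ε / 3) hε3
  -- S: domination of sub-limits at this budget
  have hdom := hS R lam hlam
  set P : ℝ → ℝ := Literature.Probability.Percolation.bondDomainCrossingProb R with hP
  set Q : ℝ → ℝ := fun δ : ℝ => Literature.Probability.Percolation.zdNearCriticalCrossingProb lam R δ
    with hQ
  -- boundedness in [0,1]
  have hP01 : ∀ δ : ℝ, P δ ∈ Icc (0 : ℝ) 1 := fun δ =>
    Literature.Probability.Percolation.bondDomainCrossingProb_mem_Icc R δ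
  have hQ01 : ∀ δ : ℝ, Q δ ∈ Icc (0 : ℝ) 1 := fun δ =>
    Literature.Probability.Percolation.zdNearCriticalCrossingProb_mem_Icc lam R δ
  have hPle : IsBoundedUnder (· ≤ ·) (𝓝[>] (0 : ℝ)) P := isBoundedUnder_of ⟨1, fun δ => (hP01 δ).2⟩
  have hQge : IsBoundedUnder (· ≥ ·) (𝓝[>] (0 : ℝ)) Q := isBoundedUnder_of ⟨0, fun δ => (hQ01 δ).1⟩
  -- the two eventual inequalities around A := limsup P
  set A : ℝ := limsup P (𝓝[>] (0 : ℝ)) with hA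
  have hPev : ∀ᶠ δ in 𝓝[>] (0 : ℝ), P δ < A + ε / 3 :=
    eventually_lt_of_limsup_lt (by linarith) hPle
  have hQev : ∀ᶠ δ in 𝓝[>] (0 : ℝ), A - ε / 3 < Q δ :=
    eventually_lt_of_lt_liminf (by linarith) hQge
  -- a common interval (0, δ₀]
  have hev : ∀ᶠ δ in 𝓝[>] (0 : ℝ), P δ < A + ε / 3 ∧ A - ε / 3 < Q δ ∧ Q δ ≤ P δ + ε / 3 :=
    hPev.and (hQev.and hWev)
  obtain ⟨δ₀, hδ₀, hsub⟩ := mem_nhdsGT_iff_exists_Ioc_subset.1 hev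
  refine ⟨δ₀, hδ₀, fun δ δ' hδ' hle hδle => ?_⟩
  have hδpos : 0 < δ := lt_of_lt_of_le hδ' hle
  have h1 := hsub ⟨hδ', hle.trans hδle⟩
  have h2 := hsub ⟨hδpos, hδle⟩
  simp only [mem_setOf_eq] at h1 h2
  obtain ⟨h1P, -, -⟩ := h1
  obtain ⟨-, h2Q, h2W⟩ := h2
  change P δ' ≤ P δ + ε
  linarith

/-- **The crux BY NAME from the two stubs** (depends on `sorryAx` ONLY through
`Holds.stub_sprinkledDomination`, `Holds.stub_windowContinuity` — this line also certifies
mechanically that the handles ARE the stub statements). -/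
theorem UniformRefinementDominance_proof : UniformRefinementDominance :=
  UniformRefinementDominance_of Holds.stub_sprinkledDomination Holds.stub_windowContinuity

end Summit.CriticalPhenomena.CardyFormulaZ2.Cruxes.UniformRefinementDominance.Birth

end
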